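import Summits.AtomisticToContinuum.HydrodynamicLimit.Theses.OneSphereInfluence
import Literature.MathematicalPhysics.KineticTheory.HardSphereEulerProofs
import Literature.Analysis.FluidPDE.HardSphereTorusMeasure

/-!
# OneSphereInfluenceHardCorePoincareDobrushinSite — Heat-bath one-site objects of the hard-sphere
local Gibbs measure

This file is part 1/9 of the DobrushinDoor chain proving the crux
`OneSphereInfluence.HardCorePoincare` (stmt-AtomisticToContinuum-13619) sorry-free; the closing
theorem `hardCorePoincare_holds` and the full account are in
`OneSphereInfluenceHardCorePoincareDobrushin.lean` (part 9/9). decomp-a2c · lens-1 · g39.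

CONTENTS. One-site weight / measure / normalisation over the configuration of the other `N`
particles, their measurability, the one-site heat-bath `Kernel` (`siteKernel`, Markov, local), and
the total-variation lemma for two normalised weights agreeing off a small set.
-/

open MeasureTheory ProbabilityTheory Set
open scoped ENNReal

noncomputable section

namespace Summit.AtomisticToContinuum.HydrodynamicLimit.Theorems.HardCorePoincareDobrushin

open Literature.MathematicalPhysics.KineticTheory Literature.Analysis.FluidPDE

section Model

variable {N : ℕ}

/-! ### One-site objects, written over the configuration of the OTHER `N` particles -/

/-- Positions free of the `N` spheres of `ω` (minimal-image distance `≥ ε` to every centre). -/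
def posFree (ε : ℝ) (ω : Config N (Fin 3) T3) : Set T3 :=
  {q | ∀ j : Fin N, ε ≤ Torus.euclidDist q (ω j).1}

/-- One-particle states whose centre is free of the spheres of `ω`. -/
def freeSet (ε : ℝ) (ω : Config N (Fin 3) T3) : Set (T3 × V3) :=
  Prod.fst ⁻¹' posFree ε ω

/-- The unnormalised one-site heat-bath weight `𝟙_{free}(y) φ(y)`. -/
def siteWeight (φ : T3 × V3 → ℝ) (ε : ℝ) (ω : Config N (Fin 3) T3) (y : T3 × V3) : ℝ≥0∞ :=
  (freeSet ε ω).indicator (fun y => ENNReal.ofReal (φ y)) y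

/-- Its total mass (the free `φ`-volume). -/
def siteNorm (φ : T3 × V3 → ℝ) (ε : ℝ) (ω : Config N (Fin 3) T3) : ℝ≥0∞ :=
  ∫⁻ y, siteWeight φ ε ω y

/-- The normalised one-site heat-bath law. -/
def siteMeasure (φ : T3 × V3 → ℝ) (ε : ℝ) (ω : Config N (Fin 3) T3) : Measure (T3 × V3) :=
  (siteNorm φ ε ω)⁻¹ • volume.withDensity (siteWeight φ ε ω)

/-- The hard-core site weight is bounded by the bare profile weight `ENNReal.ofReal (φ y)`. -/
theorem siteWeight_le (φ : T3 × V3 → ℝ) (ε : ℝ) (ω : Config N (Fin 3) T3) (y : T3 × V3) :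
    siteWeight φ ε ω y ≤ ENNReal.ofReal (φ y) :=
  Set.indicator_le_self _ _ y

/-! ### Measurability -/

/-- The minimal-image distance is jointly measurable (it is the norm of the measurable
separation map of the torus geometry). -/
theorem measurable_euclidDist₂ : Measurable fun p : T3 × T3 => Torus.euclidDist p.1 p.2 :=
  (Torus.measurable_geometry_sepVec (d := Fin 3)).norm

/-- Joint measurability of the torus distance between the inserted position and particle `j`. -/
theorem measurable_distPair (j : Fin N) :
    Measurable fun p : Config N (Fin 3) T3 × (T3 × V3) => Torus.euclidDist p.2.1 (p.1 j).1 := by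
  have h1 : Measurable fun p : Config N (Fin 3) T3 × (T3 × V3) => (p.2.1, (p.1 j).1) :=
    measurable_snd.fst.prodMk ((measurable_pi_apply j).comp measurable_fst).fst
  have h2 := measurable_euclidDist₂.comp h1
  exact h2

/-- The graph `{(ω, y) | y ∈ freeSet ε ω}` of the free region is a measurable set. -/
theorem measurableSet_freeSet_prod (ε : ℝ) :
    MeasurableSet {p : Config N (Fin 3) T3 × (T3 × V3) | p.2 ∈ freeSet ε p.1} := by
  have h : {p : Config N (Fin 3) T3 × (T3 × V3) | p.2 ∈ freeSet ε p.1} =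
      {p | ∀ j : Fin N, ε ≤ Torus.euclidDist p.2.1 (p.1 j).1} := rfl
  rw [h, setOf_forall]
  exact MeasurableSet.iInter fun j => measurableSet_le measurable_const (measurable_distPair j)

/-- The site weight is jointly measurable in the configuration and the inserted point. -/
theorem measurable_siteWeight₂ {φ : T3 × V3 → ℝ} (hφ : Measurable φ) (ε : ℝ) :
    Measurable fun p : Config N (Fin 3) T3 × (T3 × V3) => siteWeight φ ε p.1 p.2 := by
  have h1 : Measurable fun p : Config N (Fin 3) T3 × (T3 × V3) => ENNReal.ofReal (φ p.2) :=
    (hφ.comp measurable_snd).ennreal_ofReal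
  have h2 := h1.indicator (measurableSet_freeSet_prod (N := N) ε)
  have h : (fun p : Config N (Fin 3) T3 × (T3 × V3) => siteWeight φ ε p.1 p.2) =
      {p : Config N (Fin 3) T3 × (T3 × V3) | p.2 ∈ freeSet ε p.1}.indicator
        fun p => ENNReal.ofReal (φ p.2) := by
    funext p
    by_cases hp : p.2 ∈ freeSet ε p.1
    · rw [siteWeight, indicator_of_mem hp, indicator_of_mem (by exact hp)]
    · rw [siteWeight, indicator_of_notMem hp, indicator_of_notMem (by exact hp)]
  rw [h]
  exact h2

/-- For a fixed configuration the site weight is a measurable function of the inserted point. -/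
theorem measurable_siteWeight {φ : T3 × V3 → ℝ} (hφ : Measurable φ) (ε : ℝ)
    (ω : Config N (Fin 3) T3) : Measurable (siteWeight φ ε ω) := by
  have h := (measurable_siteWeight₂ (N := N) hφ ε).comp (measurable_prodMk_left (x := ω))
  exact h

/-- The normalising constant `siteNorm φ ε` is a measurable function of the configuration. -/
theorem measurable_siteNorm {φ : T3 × V3 → ℝ} (hφ : Measurable φ) (ε : ℝ) :
    Measurable (siteNorm (N := N) φ ε) := by
  have h := Measurable.lintegral_prod_right' (ν := (volume : Measure (T3 × V3)))
    (measurable_siteWeight₂ (N := N) hφ ε)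
  exact h

/-! ### The one-site heat-bath kernel on `(N+1)`-configurations -/

/-- The **one-site heat-bath kernel** of site `i`: resample particle `i` from `φ` conditioned on
not overlapping the other `N` particles (`Fin.removeNth i z`). -/
noncomputable def siteKernel {φ : T3 × V3 → ℝ} (hφ : Measurable φ) (ε : ℝ) (i : Fin (N + 1)) :
    Kernel (Config (N + 1) (Fin 3) T3) (T3 × V3) where
  toFun z := siteMeasure φ ε (i.removeNth z)
  measurable' := by
    have hrm : Measurable fun z : Config (N + 1) (Fin 3) T3 => i.removeNth z :=
      measurable_pi_iff.2 fun j => measurable_pi_apply (i.succAbove j)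
    refine Measure.measurable_of_measurable_coe _ fun A hA => ?_
    have h : (fun z : Config (N + 1) (Fin 3) T3 => siteMeasure φ ε (i.removeNth z) A) =
        (fun ω : Config N (Fin 3) T3 => (siteNorm φ ε ω)⁻¹ *
          ∫⁻ y, A.indicator (siteWeight φ ε ω) y) ∘ fun z => i.removeNth z := by
      funext z
      simp only [Function.comp_apply, siteMeasure, Measure.smul_apply, withDensity_apply _ hA,
        smul_eq_mul, lintegral_indicator hA]
    rw [h]
    refine Measurable.comp ?_ hrm
    have h3 : Measurable fun p : Config N (Fin 3) T3 × (T3 × V3) => A.indicator (siteWeight φ ε p.1) p.2 := by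
      have h4 := (measurable_siteWeight₂ (N := N) hφ ε).indicator (measurable_snd hA)
      have h5 : (fun p : Config N (Fin 3) T3 × (T3 × V3) => A.indicator (siteWeight φ ε p.1) p.2) =
          (Prod.snd ⁻¹' A).indicator fun p => siteWeight φ ε p.1 p.2 := by
        funext p
        by_cases hp : p.2 ∈ A
        · rw [indicator_of_mem hp, indicator_of_mem (by exact hp)]
        · rw [indicator_of_notMem hp, indicator_of_notMem (by exact hp)]
      rw [h5]
      exact h4
    have h6 := Measurable.lintegral_prod_right' (ν := (volume : Measure (T3 × V3))) h3
    exact (measurable_siteNorm hφ ε).inv.mul h6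

/-- Unfolding lemma: the site kernel at `i` is the site measure of the configuration with `i` removed. -/
theorem siteKernel_apply {φ : T3 × V3 → ℝ} (hφ : Measurable φ) (ε : ℝ) (i : Fin (N + 1))
    (z : Config (N + 1) (Fin 3) T3) : siteKernel hφ ε i z = siteMeasure φ ε (i.removeNth z) := rfl

/-- Locality: the kernel of site `i` does not look at particle `i`. -/
theorem siteKernel_update {φ : T3 × V3 → ℝ} (hφ : Measurable φ) (ε : ℝ) (i : Fin (N + 1))
    (z : Config (N + 1) (Fin 3) T3) (y : T3 × V3) :
    siteKernel hφ ε i (Function.update z i y) = siteKernel hφ ε i z := by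
  rw [siteKernel_apply, siteKernel_apply, Fin.removeNth_update]

/-- If the normalising constant is never `0` nor `⊤`, the site kernel is a Markov kernel. -/
theorem isMarkovKernel_siteKernel {φ : T3 × V3 → ℝ} (hφ : Measurable φ) (ε : ℝ) (i : Fin (N + 1))
    (h0 : ∀ ω : Config N (Fin 3) T3, siteNorm φ ε ω ≠ 0)
    (htop : ∀ ω : Config N (Fin 3) T3, siteNorm φ ε ω ≠ ⊤) :
    IsMarkovKernel (siteKernel hφ ε i) := by
  refine ⟨fun z => ⟨?_⟩⟩
  rw [siteKernel_apply, siteMeasure, Measure.smul_apply, withDensity_apply _ MeasurableSet.univ,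
    Measure.restrict_univ, smul_eq_mul]
  exact ENNReal.inv_mul_cancel (h0 _) (htop _)

/-- Lower integral against the site kernel: the normalised weighted integral formula. -/
theorem lintegral_siteKernel {φ : T3 × V3 → ℝ} (hφ : Measurable φ) (ε : ℝ) (i : Fin (N + 1))
    (z : Config (N + 1) (Fin 3) T3) {g : T3 × V3 → ℝ≥0∞} (hg : Measurable g) :
    ∫⁻ y, g y ∂(siteKernel hφ ε i z) =
      (siteNorm φ ε (i.removeNth z))⁻¹ * ∫⁻ y, siteWeight φ ε (i.removeNth z) y * g y := by
  rw [siteKernel_apply, siteMeasure, lintegral_smul_measure, smul_eq_mul,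
    lintegral_withDensity_eq_lintegral_mul _ (measurable_siteWeight hφ ε _) hg]
  rfl

/-! ### Total variation of two normalised weights agreeing off a small set -/

/-- Elementary ratio estimate: `a / n ≤ a' / n' + 2 * (m / L)` under the stated perturbation bounds. -/
theorem div_le_div_add_two_mul {a a' n n' m L : ℝ} (hL : 0 < L) (hLn : L ≤ n) (hLn' : L ≤ n')
    (ha' : 0 ≤ a') (ha'n : a' ≤ n') (hm : 0 ≤ m) (h1 : a ≤ a' + m) (h2 : n' ≤ n + m) :
    a / n ≤ a' / n' + 2 * (m / L) := by
  have hn : 0 < n := hL.trans_le hLn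
  have hn' : 0 < n' := hL.trans_le hLn'
  have s1 : a / n ≤ a' / n + m / n := by
    rw [← add_div]; exact div_le_div_of_nonneg_right h1 hn.le
  have s2 : a' / n ≤ a' / n' + m / n := by
    have key : a' * n' ≤ a' * n + n' * m := by
      calc a' * n' ≤ a' * (n + m) := mul_le_mul_of_nonneg_left h2 ha'
        _ = a' * n + a' * m := mul_add _ _ _
        _ ≤ a' * n + n' * m := by gcongr
    rw [div_add_div _ _ hn'.ne' hn.ne', div_le_div_iff₀ hn (mul_pos hn' hn)]
    nlinarith [mul_le_mul_of_nonneg_right key hn.le]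
  have s3 : m / n ≤ m / L := div_le_div_of_nonneg_left hm hL hLn
  linarith

/-- Set integrals of two weights that agree off `S` and are dominated by `ψ` differ by at most
`∫_S ψ`. -/
theorem setLIntegral_le_add_of_eqOn_compl {Y : Type*} [MeasurableSpace Y] {ν : Measure Y}
    {v v' ψ : Y → ℝ≥0∞} {S : Set Y} (hS : MeasurableSet S) (hv : ∀ y, v y ≤ ψ y)
    (hvv' : ∀ y, y ∉ S → v y = v' y) {B : Set Y} (hB : MeasurableSet B) :
    ∫⁻ y in B, v y ∂ν ≤ ∫⁻ y in B, v' y ∂ν + ∫⁻ y in S, ψ y ∂ν := by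
  calc ∫⁻ y in B, v y ∂ν = ∫⁻ y in B ∩ S, v y ∂ν + ∫⁻ y in B \ S, v y ∂ν :=
        (lintegral_inter_add_sdiff _ _ hS).symm
    _ ≤ ∫⁻ y in S, ψ y ∂ν + ∫⁻ y in B, v' y ∂ν := by
        refine add_le_add ?_ ?_
        · exact (lintegral_mono_set inter_subset_right).trans (lintegral_mono fun y => hv y)
        · calc ∫⁻ y in B \ S, v y ∂ν = ∫⁻ y in B \ S, v' y ∂ν :=
                setLIntegral_congr_fun (hB.diff hS) fun y hy => hvv' y hy.2
            _ ≤ ∫⁻ y in B, v' y ∂ν := lintegral_mono_set fun y hy => hy.1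
    _ = _ := add_comm _ _

/-- **Total-variation bound**: two normalised weights agreeing off a set `S` of reference mass `m`,
both of total mass `≥ L > 0`, differ on every event by at most `2 m / L`. -/
theorem toReal_normalised_le {Y : Type*} [MeasurableSpace Y] {ν : Measure Y}
    {w w' ψ : Y → ℝ≥0∞} {S : Set Y} (hS : MeasurableSet S)
    (hle : ∀ y, w y ≤ ψ y) (hle' : ∀ y, w' y ≤ ψ y) (heq : ∀ y, y ∉ S → w y = w' y)
    {L : ℝ≥0∞} (hL0 : L ≠ 0) (hLn : L ≤ ∫⁻ y, w y ∂ν) (hLn' : L ≤ ∫⁻ y, w' y ∂ν)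
    (hn : ∫⁻ y, w y ∂ν ≠ ⊤) (hn' : ∫⁻ y, w' y ∂ν ≠ ⊤) (hm : ∫⁻ y in S, ψ y ∂ν ≠ ⊤)
    {A : Set Y} (hA : MeasurableSet A) :
    (((∫⁻ y, w y ∂ν)⁻¹ • ν.withDensity w) A).toReal ≤
      (((∫⁻ y, w' y ∂ν)⁻¹ • ν.withDensity w') A).toReal +
        2 * ((∫⁻ y in S, ψ y ∂ν).toReal / L.toReal) := by
  have hLtop : L ≠ ⊤ := ne_top_of_le_ne_top hn hLn
  have haA : ∫⁻ y in A, w y ∂ν ≠ ⊤ := ne_top_of_le_ne_top hn (setLIntegral_le_lintegral A _)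
  have haA' : ∫⁻ y in A, w' y ∂ν ≠ ⊤ := ne_top_of_le_ne_top hn' (setLIntegral_le_lintegral A _)
  have e1 : (((∫⁻ y, w y ∂ν)⁻¹ • ν.withDensity w) A).toReal =
      (∫⁻ y in A, w y ∂ν).toReal / (∫⁻ y, w y ∂ν).toReal := by
    rw [Measure.smul_apply, withDensity_apply _ hA, smul_eq_mul, ENNReal.toReal_mul,
      ENNReal.toReal_inv, inv_mul_eq_div]
  have e2 : (((∫⁻ y, w' y ∂ν)⁻¹ • ν.withDensity w') A).toReal =
      (∫⁻ y in A, w' y ∂ν).toReal / (∫⁻ y, w' y ∂ν).toReal := by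
    rw [Measure.smul_apply, withDensity_apply _ hA, smul_eq_mul, ENNReal.toReal_mul,
      ENNReal.toReal_inv, inv_mul_eq_div]
  rw [e1, e2]
  have h1 : ∫⁻ y in A, w y ∂ν ≤ ∫⁻ y in A, w' y ∂ν + ∫⁻ y in S, ψ y ∂ν :=
    setLIntegral_le_add_of_eqOn_compl hS hle heq hA
  have h2 : ∫⁻ y, w' y ∂ν ≤ ∫⁻ y, w y ∂ν + ∫⁻ y in S, ψ y ∂ν := by
    have := setLIntegral_le_add_of_eqOn_compl (ν := ν) hS hle' (fun y hy => (heq y hy).symm)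
      MeasurableSet.univ
    simpa only [Measure.restrict_univ] using this
  refine div_le_div_add_two_mul (ENNReal.toReal_pos hL0 hLtop) (ENNReal.toReal_mono hn hLn)
    (ENNReal.toReal_mono hn' hLn') ENNReal.toReal_nonneg
    (ENNReal.toReal_mono hn' (setLIntegral_le_lintegral A _)) ENNReal.toReal_nonneg ?_ ?_
  · have := ENNReal.toReal_mono (ENNReal.add_ne_top.2 ⟨haA', hm⟩) h1
    rwa [ENNReal.toReal_add haA' hm] at this
  · have := ENNReal.toReal_mono (ENNReal.add_ne_top.2 ⟨hn, hm⟩) h2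
    rwa [ENNReal.toReal_add hn hm] at this

end Model

end Summit.AtomisticToContinuum.HydrodynamicLimit.Theorems.HardCorePoincareDobrushin

end
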